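import Summits.ResolutionOfSingularities.ResolutionOfSingularities.Theorems.HilbertSamuelEliminationSigmaMaxModificationsCorridor3WLadderLineageGenericPoints
import HarnessLib

/-!
# [OURS · L1 W4.2] Lifting a point to the localisation `X' ×_X Spec 𝒪_{X,x}`: the lift is CLOSED when the point is the only
# point of its own closure in the fibre — and that holds as soon as its height does not exceed the height of its image
# (η-thread bricks «one storey up», centre-free; crux chain w42, line `w_ladder`; `--supports stmt-ResolutionOfSingularities-19249`, helper)

OURS (cell res-hironaka, slot W4.2, seat res-type-053 gen 9; by-product of D3 «(T) TRANSFER ROW», for the hands of D13 «(b-end)₃ moving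
births» / D6 and any «fibre birth one dimension down», res-L1-w42-plan-1 RULINGS v3.12-1 (D)); NOT statements of H. Hironaka's manuscript
[Hironaka2017] nor of [CossartJannsenSaito2020]. AI-drafted, weaker than expert review. Sorry-free PROOF file (no definition, no named
fact, no binder). The centre-free core of `…Corridor3WLadderLocalChainsLocalize.isLocalNearPointStep_of_isBlowup` (p514855), extracted
for reuse with NON-point centres (curve germs, CJS Ch. 12 «Case 2»):

* `eq_of_specializes_of_height_le` — for `f : X ⟶ Y` universally closed and `x ⤳ y` in one fibre: if `height x ≤ height (f x) < ⊤`
  then `y = x` (file A's `height_base_add_one_le_height`); e.g. the generic point of a CURVE born over a CURVE (both of height `1`),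
  or of a surface over a surface;
* `exists_isClosed_lift_fromSpecStalk` — for ANY morphism `π : X' ⟶ X` and `x'` over `x` which is the only point over `x` it specializes
  to: the lift `b` of `x'` to `X' ×_X Spec 𝒪_{X,x}` (res-L1-w42-stub-2's `exists_lift_pullback_fromSpecStalk`, p504248) lies over the
  closed point, is a CLOSED point, and `𝒪_b ≅ 𝒪_{X',x'}` (stalk map of the first projection an isomorphism); with `isLocalSchemeAt_Spec_of_iso`
  / `isLocalSchemeAt_of_isIso_stalkMap` this re-localises a thread at `b`;
* `exists_isClosed_lift_fromSpecStalk_of_height_le` — the two combined.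

References: CJS LNM 2270 (2020) Lemma 6.30 (proof via `X_η`, p. 97), Ch. 12 Case 2 (p. 152), p. 107 [CossartJannsenSaito2020]; Stacks
Tags 01J7, 00GU [StacksProject].
-/

noncomputable section

set_option linter.dupNamespace false -- namespace `…Corridor3.Moving` re-enters `…Corridor3` (Moving files' convention)

open CategoryTheory CategoryTheory.Limits AlgebraicGeometry TopologicalSpace Topology IsLocalRing Order
open Literature.AlgebraicGeometry.Resolution

universe u

namespace Summit.ResolutionOfSingularities.ResolutionOfSingularities.Theorems.SigmaMaxModificationsCorridor3.Moving

/-- **A point whose height does not exceed its image's is the only point of its closure in its fibre** (for a universally closed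
morphism; file A `height_base_add_one_le_height`): `x ⤳ y`, `f y = f x`, `height x ≤ height (f x) < ⊤` ⟹ `y = x`.
[cite: StacksProject, Tag 00GU] -/
theorem eq_of_specializes_of_height_le {X Y : Scheme.{u}} (f : X ⟶ Y) [UniversallyClosed f] {x y : X} (hxy : x ⤳ y)
    (hfy : f.base y = f.base x) (hfin : height (f.base x) ≠ ⊤) (hle : height x ≤ height (f.base x)) : y = x := by
  by_contra hne
  have h := (height_base_add_one_le_height f hxy (Ne.symm hne) hfy).trans hle
  obtain ⟨n, hn⟩ := ENat.ne_top_iff_exists.mp hfin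
  rw [← hn] at h
  exact absurd (by exact_mod_cast h : n + 1 ≤ n) (Nat.not_succ_le_self n)

/-- **THE LIFT OF A POINT TO THE LOCALISATION IS CLOSED WHEN THE POINT IS ALONE OVER `x` IN ITS CLOSURE.** For any `π : X' ⟶ X`
and `x'` over `x` such that every `y` with `x' ⤳ y` over `x` is `x'`: the lift `b` of `x'` to `X' ×_X Spec 𝒪_{X,x}` lies over the
closed point, `{b}` is CLOSED (a specialization `b ⤳ b'` lies over the closed point — the closed point of a local scheme is closed —
so the image of `b'` in `X'` is a specialization of `x'` over `x`, hence `x'`, and the first projection is injective, being a base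
change of the preimmersion `Spec 𝒪_{X,x} → X`), and `𝒪_b ≅ 𝒪_{X',x'}`. [cite: StacksProject, Tag 01J7] -/
theorem exists_isClosed_lift_fromSpecStalk {X' X : Scheme.{u}} (π : X' ⟶ X) {x : X} {x' : X'} (hover : π.base x' = x)
    (huniq : ∀ y : X', x' ⤳ y → π.base y = x → y = x') :
    ∃ b : ↥(pullback π (X.fromSpecStalk x)),
      (pullback.fst π (X.fromSpecStalk x)).base b = x' ∧
        (pullback.snd π (X.fromSpecStalk x)).base b = closedPoint (X.presheaf.stalk x) ∧
          IsClosed ({b} : Set ↥(pullback π (X.fromSpecStalk x))) ∧ IsIso ((pullback.fst π (X.fromSpecStalk x)).stalkMap b) := by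
  have hc : (X.fromSpecStalk x).base (closedPoint (X.presheaf.stalk x)) = x := Scheme.fromSpecStalk_closedPoint
  obtain ⟨b, hb, hbs, hbiso⟩ := exists_lift_pullback_fromSpecStalk π x hover
  have hsnd : (pullback.snd π (X.fromSpecStalk x)).base b = closedPoint (X.presheaf.stalk x) :=
    eq_closedPoint_of_fromSpecStalk_eq hbs
  refine ⟨b, hb, hsnd, ?_, hbiso⟩
  have hcl : closure ({b} : Set ↥(pullback π (X.fromSpecStalk x))) ⊆ {b} := by
    intro b' hb'
    have hbb' : b ⤳ b' := specializes_iff_mem_closure.mpr hb'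
    have h1 : x' ⤳ (pullback.fst π (X.fromSpecStalk x)).base b' :=
      hb ▸ hbb'.map (pullback.fst π (X.fromSpecStalk x)).continuous
    have h2 : (pullback.snd π (X.fromSpecStalk x)).base b' = closedPoint (X.presheaf.stalk x) := by
      have hsp : closedPoint (X.presheaf.stalk x) ⤳ (pullback.snd π (X.fromSpecStalk x)).base b' :=
        hsnd ▸ hbb'.map (pullback.snd π (X.fromSpecStalk x)).continuous
      exact Set.mem_singleton_iff.mp (hsp.mem_closed (isClosed_singleton_of_fromSpecStalk_eq hc) rfl)
    have h3 : π.base ((pullback.fst π (X.fromSpecStalk x)).base b') = x := by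
      have h' : (pullback.fst π (X.fromSpecStalk x) ≫ π).base b' =
          (pullback.snd π (X.fromSpecStalk x) ≫ X.fromSpecStalk x).base b' := by
        rw [pullback.condition]
      rw [Scheme.Hom.comp_base, Scheme.Hom.comp_base, TopCat.comp_app, TopCat.comp_app, h2, hc] at h'
      exact h'
    have hinj : Function.Injective (pullback.fst π (X.fromSpecStalk x)).base :=
      (pullback.fst π (X.fromSpecStalk x)).isEmbedding.injective
    exact Set.mem_singleton_iff.mpr (hinj ((huniq _ h1 h3).trans hb.symm))
  exact isClosed_of_closure_subset hcl

/-- **Combined form for generic points of equal height** (e.g. a curve born dominating a curve): for `π : X' ⟶ X` universally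
closed and `x'` with `height x' ≤ height (π x') < ⊤`, the lift of `x'` to `X' ×_X Spec 𝒪_{X,π x'}` over the closed point is a
closed point with `𝒪 ≅ 𝒪_{X',x'}`. [cite: StacksProject, Tag 00GU] -/
theorem exists_isClosed_lift_fromSpecStalk_of_height_le {X' X : Scheme.{u}} (π : X' ⟶ X) [UniversallyClosed π] {x : X}
    {x' : X'} (hover : π.base x' = x) (hfin : height x ≠ ⊤) (hle : height x' ≤ height x) :
    ∃ b : ↥(pullback π (X.fromSpecStalk x)),
      (pullback.fst π (X.fromSpecStalk x)).base b = x' ∧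
        (pullback.snd π (X.fromSpecStalk x)).base b = closedPoint (X.presheaf.stalk x) ∧
          IsClosed ({b} : Set ↥(pullback π (X.fromSpecStalk x))) ∧ IsIso ((pullback.fst π (X.fromSpecStalk x)).stalkMap b) := by
  subst hover
  exact exists_isClosed_lift_fromSpecStalk π rfl fun y hy hfy => eq_of_specializes_of_height_le π hy hfy hfin hle

end Summit.ResolutionOfSingularities.ResolutionOfSingularities.Theorems.SigmaMaxModificationsCorridor3.Moving

end
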